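import Summits.ResolutionOfSingularities.ResolutionOfSingularities.Theorems.FrobeniusLadderFInjectiveMacaulayficationFCForallExistsOfFullModel
import Summits.ResolutionOfSingularities.ResolutionOfSingularities.Theorems.FrobeniusLadderFInjectiveMacaulayficationFCUnguarded
import Summits.ResolutionOfSingularities.ResolutionOfSingularities.Theorems.FrobeniusLadderFInjectiveMacaulayficationRegularPointClause
import Literature.AlgebraicGeometry.Resolution.ThreefoldResolutionOneBlowup
import Literature.AlgebraicGeometry.Resolution.QuasiExcellentSchemes
import Literature.AlgebraicGeometry.CossartPiltant200819.GoodResolutionOneBlowupQuasiExcellent2019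
import HarnessLib.Audit
import HarnessLib

/-!
# FC″ in dimension three: `FCUnguardedDimEq3` and its proof from the threefold resolution facts (crux `FInjectiveMacaulayfication`, door v30)

Support file for crux stmt-ResolutionOfSingularities-15315 (`FrobeniusLadder.FInjectiveMacaulayfication`), chain w45a. [OURS · L1 W4.5a] —
NOT a statement of any manuscript [claim: Hironaka2017]; AI-written, weaker than expert review; no statement of the manuscript is used;
the named facts enter only as hypotheses. Row (β) of res-L1-w45a-plan-1 RULING R13.42 («the `…DimEq3OfCP`-type corollary, aimed at FC″
with the same `𝓛`», res-L1-w45a-strat-1 2026-08-27T15:42:15Z (1)); sibling of `ClosedCentreDimEq3` (the closed stub `#4β` in dimension three).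

Door v30 (`DoorUnguarded`, R13.35) has the three stubs `stub_dattaMurayama`, `stub_closedCentreExists` (#4β) and `stub_fcUnguarded`
(FC″ = `GenericFibreReduction.FCUnguarded`, p543297: at an F-bad NON-CLOSED point `η` of an admissible `X₁` all of whose proper
generizations are F-good, there are an ideal sheaf `J ≠ ⊥` with `η ∈ Supp J` and a LocFix datum `c'` at `η` with `stalkIdeal J η = (c')`
such that every blowing up along `J` is FULL at the non-closed points over `Supp J ∖ {η}` and CM at the closed points over `Supp J`).

This file lands the **dimension-three rung of FC″**: `FCUnguarded` with the single extra hypothesis `topologicalKrullDim X₁ = 3`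
(inserted after `IsIntegral X₁`, the convention of `FCForallExistsDimLe2` / `ClosedCentreDimEq3`) holds GIVEN the three named facts
behind the tree's one-blowing-up resolution of threefolds `Literature.AlgebraicGeometry.Resolution.exists_isBlowup_isRegular_of_dim_three`:
Cossart–Piltant 2019 Thm. 1.1 (i)(ii) (`CossartPiltant2019General`), Raynaud–Gruson flattening / Stacks 081R (`Stacks081R`, hypothesis BY
NAME) and CP 2019 Prop. 4.4 (`CossartPiltant2019Principalization`). Proof: that theorem gives `𝓛 ≠ ⊥` and a blowing up `ρ : T → X₁`
along `𝓛` with `T` regular and `Supp 𝓛 = X₁ ∖ Reg X₁` (`CP2019.support_eq_compl_regularLocus_of_isBlowup_of_isRegular`); the F-bad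
point `η` is not regular (`RegularPointClause.fiClause_of_mem_regularLocus`), so `η ∈ Supp 𝓛`; every stalk of the regular `T` is FULL;
and the FC′/FC″ consumer `FCForallExistsOfFullModel.fcForallExists_body_of_fullModel_of_isIntegral` (p534642) turns (`J := 𝓛`,
`c' :=` generators of `𝓛_η`, the FULL model `ρ`, `IsBlowup.unique`) into the seven conjuncts of the conclusion. So in dimension three
FC″ needs no LocFix theory, no spreading and no Macaulayfication: the centre `𝓛` resolves outright; FC″'s informative regime is `dim X₁ ≥ 4`.

* `FCUnguardedDimEq3` — the statement (FC″ verbatim + `topologicalKrullDim X₁ = 3`);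
* `fcUnguardedDimEq3_of_fcUnguarded` — FC″ ⇒ its dimension-three rung (identity check of the text);
* `fcUnguardedDimEq3_of_cp` — the rung from the three named facts (universe `0`).
-/

-- single-problem summit: the doubled namespace component is forced
set_option linter.dupNamespace false

noncomputable section

open AlgebraicGeometry CategoryTheory Literature.AlgebraicGeometry.Resolution TopologicalSpace IsLocalRing
open Literature.AlgebraicGeometry.CossartPiltant200819

namespace Summit.ResolutionOfSingularities.ResolutionOfSingularities.Theorems.FInjectiveMacaulayfication.FCUnguardedDimEq3

open Summit.ResolutionOfSingularities.ResolutionOfSingularities.Theorems.FInjectiveMacaulayfication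

/-- [OURS · candidate statement, PROVED below modulo the three named facts] **FC″ for threefolds** — the text of
`GenericFibreReduction.FCUnguarded` VERBATIM with the single extra hypothesis `topologicalKrullDim X₁ = 3` inserted after `IsIntegral X₁`:
for an admissible integral threefold `X₁` (separated, locally of finite type, quasi-compact over a field of characteristic `p`, all stalks
CM) and a NON-CLOSED F-bad point `η` all of whose proper generizations are F-good, there are `J ≠ ⊥` with `η ∈ Supp J` and a LocFix datum
`c'` at `η` (`(c') ≠ ⊥`, `(c') ≤ 𝔪_η`, charts FULL over `𝔪_η`, `stalkIdeal J η = (c')`) such that every blowing up along `J` is FULL at the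
non-closed points over `Supp J ∖ {η}` and CM at the closed points over `Supp J`. [candidate statement, OURS] -/
@[conjecture] def FCUnguardedDimEq3 : Prop :=
  ∀ (p : ℕ), p.Prime → ∀ (k : Type) [Field k] [CharP k p]
    (X₁ : Scheme.{0}) (f₁ : X₁ ⟶ Spec (.of k)),
      IsSeparated f₁ → LocallyOfFiniteType f₁ → QuasiCompact f₁ → IsIntegral X₁ → topologicalKrullDim X₁ = 3 →
      (∀ x : X₁, (∀ d : ℕ, ringKrullDim (X₁.presheaf.stalk x) = d → ∀ s : Fin d → X₁.presheaf.stalk x,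
        (Ideal.span (Set.range s)).radical.IsMaximal → RingTheory.Sequence.IsWeaklyRegular (X₁.presheaf.stalk x) (List.ofFn s))) →
      ∀ η : X₁, (¬ IsClosed ({η} : Set X₁) ∧ ¬ (∀ d : ℕ, ringKrullDim (X₁.presheaf.stalk η) = d → ∀ s : Fin d → X₁.presheaf.stalk η,
          (Ideal.span (Set.range s)).radical.IsMaximal → ∀ t : X₁.presheaf.stalk η, (∃ e : ℕ, t ^ p ^ e ∈
            Ideal.span ((fun z : X₁.presheaf.stalk η => z ^ p ^ e) '' (Ideal.span (Set.range s) : Set (X₁.presheaf.stalk η)))) →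
              t ∈ Ideal.span (Set.range s)) ∧
        ∀ y : X₁, y ⤳ η → y ≠ η → (∀ d : ℕ, ringKrullDim (X₁.presheaf.stalk y) = d → ∀ s : Fin d → X₁.presheaf.stalk y,
          (Ideal.span (Set.range s)).radical.IsMaximal → ∀ t : X₁.presheaf.stalk y, (∃ e : ℕ, t ^ p ^ e ∈
            Ideal.span ((fun z : X₁.presheaf.stalk y => z ^ p ^ e) '' (Ideal.span (Set.range s) : Set (X₁.presheaf.stalk y)))) →
              t ∈ Ideal.span (Set.range s))) →
      ∃ (J : X₁.IdealSheafData) (n' : ℕ) (c' : Fin n' → X₁.presheaf.stalk η), J ≠ ⊥ ∧ η ∈ (J.support : Set X₁) ∧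
      -- the RE-CHOSEN LocFix datum c' at η (currency (A′)): nonzero, inside 𝔪_η, charts FULL over 𝔪_η
      Ideal.span (Set.range c') ≠ ⊥ ∧ Ideal.span (Set.range c') ≤ maximalIdeal (X₁.presheaf.stalk η) ∧
        (∀ (j : Fin n') (𝔔 : PrimeSpectrum (blowupAlgebra (Ideal.span (Set.range c')) (c' j))),
          𝔔.asIdeal.comap (algebraMap (X₁.presheaf.stalk η) (blowupAlgebra (Ideal.span (Set.range c')) (c' j))) =
            maximalIdeal (X₁.presheaf.stalk η) →
          IsDomain (Localization.AtPrime 𝔔.asIdeal) ∧ ∀ d : ℕ, ringKrullDim (Localization.AtPrime 𝔔.asIdeal) = d →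
            ∀ s : Fin d → Localization.AtPrime 𝔔.asIdeal, (Ideal.span (Set.range s)).radical.IsMaximal →
              RingTheory.Sequence.IsWeaklyRegular (Localization.AtPrime 𝔔.asIdeal) (List.ofFn s) ∧
              ∀ y : Localization.AtPrime 𝔔.asIdeal, (∃ e : ℕ, y ^ p ^ e ∈ Ideal.span ((fun z : Localization.AtPrime 𝔔.asIdeal => z ^ p ^ e) ''
                (Ideal.span (Set.range s) : Set (Localization.AtPrime 𝔔.asIdeal)))) → y ∈ Ideal.span (Set.range s)) ∧
      stalkIdeal J η = Ideal.span (Set.range c') ∧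
      (∀ (X₂ : Scheme.{0}) (π : X₂ ⟶ X₁), IsBlowup π J →
        (∀ x : X₂, π.base x ∈ (J.support : Set X₁) → π.base x ≠ η → ¬ IsClosed ({x} : Set X₂) →
          IsDomain (X₂.presheaf.stalk x) ∧ ∀ d : ℕ, ringKrullDim (X₂.presheaf.stalk x) = d → ∀ s : Fin d → X₂.presheaf.stalk x,
            (Ideal.span (Set.range s)).radical.IsMaximal → RingTheory.Sequence.IsWeaklyRegular (X₂.presheaf.stalk x) (List.ofFn s) ∧
            ∀ t : X₂.presheaf.stalk x, (∃ e : ℕ, t ^ p ^ e ∈ Ideal.span ((fun z : X₂.presheaf.stalk x => z ^ p ^ e) ''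
              (Ideal.span (Set.range s) : Set (X₂.presheaf.stalk x)))) → t ∈ Ideal.span (Set.range s)) ∧
        (∀ x : X₂, π.base x ∈ (J.support : Set X₁) → IsClosed ({x} : Set X₂) →
          ∀ d : ℕ, ringKrullDim (X₂.presheaf.stalk x) = d → ∀ s : Fin d → X₂.presheaf.stalk x,
            (Ideal.span (Set.range s)).radical.IsMaximal → RingTheory.Sequence.IsWeaklyRegular (X₂.presheaf.stalk x) (List.ofFn s)))

/-- **FC″ ⇒ FC″ in dimension three** (discard the dimension hypothesis; identity check of the text against
`GenericFibreReduction.FCUnguarded`). [folklore] -/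
theorem fcUnguardedDimEq3_of_fcUnguarded (h : GenericFibreReduction.FCUnguarded) : FCUnguardedDimEq3 :=
  fun p hp k _ _ X₁ f₁ hs hft hqc hi _ => h p hp k X₁ f₁ hs hft hqc hi

/-- **FC″ holds for threefolds, given CP 2019 Thm. 1.1 (i)(ii), Raynaud–Gruson flattening and CP 2019 Prop. 4.4.** The centre is the
ideal sheaf `𝓛` of the tree's one-blowing-up resolution `exists_isBlowup_isRegular_of_dim_three`: `Supp 𝓛 = X₁ ∖ Reg X₁ ∋ η` (an F-bad
point is not regular: `RegularPointClause.fiClause_of_mem_regularLocus`), the blowing up `ρ : T → X₁` along `𝓛` has `T` regular hence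
FULL stalks, and `FCForallExistsOfFullModel.fcForallExists_body_of_fullModel_of_isIntegral` delivers the conclusion (`c' :=` generators
of `𝓛_η`; every other blowing up along `𝓛` is isomorphic to `ρ` over `X₁`).
[cite: CossartPiltant2019, Thm. 1.1 (i)(ii); Prop. 4.4] [cite: StacksProject, Tag 081T; Tag 080B]
[cite: Matsumura1987, Thm. 17.4] [cite: Fedder1983, Prop. 1.7] -/
theorem fcUnguardedDimEq3_of_cp
    (hG : CossartPiltant2019General.{0}) (h081R : Stacks081R.{0}) (hP : CossartPiltant2019Principalization.{0}) :
    FCUnguardedDimEq3 := by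
  intro p hp k _ _ X₁ f₁ hs hl hq hi hdim _ η hη
  haveI : Fact p.Prime := ⟨hp⟩
  haveI := hs
  haveI := hl
  haveI := hq
  haveI := hi
  haveI : X₁.IsSeparated := Scheme.isSeparated_of_isSeparated_over f₁
  haveI : IsNoetherian X₁ := Scheme.isNoetherian_of_finiteType_over_field f₁
  obtain ⟨𝓛, T, ρ, h𝓛ne, hρ, hTreg, U, hU, h𝓛supp, -⟩ :=
    exists_isBlowup_isRegular_of_dim_three hG h081R hP f₁ hdim
  have hsupp : (𝓛.support : Set X₁) = (Scheme.regularLocus X₁)ᶜ :=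
    CP2019.support_eq_compl_regularLocus_of_isBlowup_of_isRegular hρ hTreg (hU ▸ h𝓛supp)
  -- the F-bad point `η` is not regular, hence lies in `Supp 𝓛 = X₁ ∖ Reg X₁`
  have hη𝓛 : η ∈ (𝓛.support : Set X₁) := by
    rw [hsupp]
    intro hreg
    exact hη.2.1 fun d hd s hrad => ((RegularPointClause.fiClause_of_mem_regularLocus p f₁ η hreg).2 d hd s hrad).2
  -- the FULL model: every stalk of the regular `T` satisfies the full clause
  refine FCForallExistsOfFullModel.fcForallExists_body_of_fullModel_of_isIntegral p X₁ η 𝓛 h𝓛ne hη𝓛 T ρ hρ ?_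
  intro t _
  have ht : t ∈ Scheme.regularLocus T := by
    rw [hTreg.regularLocus_eq_univ]; trivial
  exact RegularPointClause.fiClause_of_mem_regularLocus p (ρ ≫ f₁) t ht

end Summit.ResolutionOfSingularities.ResolutionOfSingularities.Theorems.FInjectiveMacaulayfication.FCUnguardedDimEq3

end
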